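import Literature.Computability.AlgebraicComplexity.OrderedMonomials
import Mathlib.Analysis.Real.Sqrt
import Mathlib.Data.Fintype.CardEmbedding
import Mathlib.Data.Fintype.Perm
import HarnessLib

/-!
# The `+`-ladder above the permanent, I: the rung polynomial and the permutation mass

Definitions and bookkeeping for `SoloBlindPlusLadder.lean` (the lower bound
`min(2^{⌈n/3⌉}, √(1+M)) ≤ 8 s (n+1)²` for monotone circuits computing `F_{n,n} + M · per_n`):

* `fullSML n = ∏_i ∑_j x_{ij} = ∑_{ν : [n] → [n]} x_ν`, `perNN n = ∑_{σ ∈ S_n} x_σ`,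
  `ladder n M = fullSML n + M · perNN n` over `ℝ≥0`, their coefficients at map monomials
  `monoMap ν`, and set-multilinearity (`isFullyOrdered_ladder`);
* the permutation mass `mass p = ∑_{ν bijective} p(x_ν)` (additive; `≥ n!(1+M)` on the rung);
* gluing Alice's map `τ : A → [n]` and Bob's `θ : Aᶜ → [n]`: the glued map is a bijection iff
  both are injective with complementary images (`bijective_glue_iff`), and the coefficient of an
  ordered product `a b` there is `a(x_τ) b(x_θ)` (`coeff_glue`);
* counting: injective maps `B → [n]` number `≤ n^{(|B|)}` and those with a prescribed image
  `≤ |B|!`; `2^j ≤ C(n,k)` for `j ≤ min(k, n-k)`, whence `k!(n-k)! 2^{⌈n/3⌉} ≤ n!` in the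
  balanced range `n < 3k ≤ 2n`; and the quadratic-inequality step `μ² ≤ Zμ + ZN ⇒ μ ≤ Z + √(ZN)`.

References: M. Jerrum, M. Snir, J. ACM 29 (1982); structure theorem as in
Chattopadhyay–Datta–Ghosal–Mukhopadhyay (arXiv:2109.06941) §2, here the tree's
`ArithCircuit.exists_balanced_decomposition`.
-/

noncomputable section

open scoped NNReal Nat Classical
open MvPolynomial Finset Literature.Computability.AlgebraicComplexity

namespace Summit.ValiantsHypothesis.ValiantsHypothesis.Theorems

namespace PlusLadder

variable {n : ℕ}

/-! ### The polynomials -/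

/-- The monomial of a map is the product of its variables. -/
theorem prod_X_eq_monomial_monoMap (ν : Fin n → Fin n) :
    (∏ i, X (i, ν i) : MvPolynomial (Fin n × Fin n) ℝ≥0) = monomial (monoMap ν) 1 := by
  have hX : ∀ p : Fin n × Fin n,
      (X p : MvPolynomial (Fin n × Fin n) ℝ≥0) = monomial (Finsupp.single p 1) 1 := fun p => rfl
  have key : ∀ s : Finset (Fin n), (∏ i ∈ s, X (i, ν i) : MvPolynomial (Fin n × Fin n) ℝ≥0)
      = monomial (∑ i ∈ s, Finsupp.single (i, ν i) 1) 1 := by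
    intro s
    induction s using Finset.induction_on with
    | empty => rw [prod_empty, sum_empty, ← C_apply, C_1]
    | insert i s hi ih => rw [prod_insert hi, sum_insert hi, ih, hX, monomial_mul, one_mul]
  simpa [monoMap] using key univ

/-- `F_{n,n} = ∏_i ∑_j x_{i,j} = ∑_{ν : [n] → [n]} x_ν` over `ℝ≥0`. -/
def fullSML (n : ℕ) : MvPolynomial (Fin n × Fin n) ℝ≥0 :=
  ∑ ν : Fin n → Fin n, monomial (monoMap ν) 1

/-- The permanent over `ℝ≥0`: `per_n = ∑_{σ ∈ S_n} x_σ`. -/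
def perNN (n : ℕ) : MvPolynomial (Fin n × Fin n) ℝ≥0 :=
  ∑ σ : Equiv.Perm (Fin n), monomial (monoMap ⇑σ) 1

/-- The rung polynomial `F_{n,n} + M · per_n`. -/
def ladder (n : ℕ) (M : ℝ≥0) : MvPolynomial (Fin n × Fin n) ℝ≥0 :=
  fullSML n + C M * perNN n

/-- `perNN` is the permanent `∑_σ ∏_i x_{i,σ i}`. -/
theorem perNN_eq_sum_prod : perNN n = ∑ σ : Equiv.Perm (Fin n), ∏ i, X (i, σ i) := by
  unfold perNN
  exact sum_congr rfl fun σ _ => (prod_X_eq_monomial_monoMap ⇑σ).symm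

/-- `fullSML` as the sum over all maps of their monomials. -/
theorem fullSML_eq_sum_prod : fullSML n = ∑ ν : Fin n → Fin n, ∏ i, X (i, ν i) := by
  unfold fullSML
  exact sum_congr rfl fun ν _ => (prod_X_eq_monomial_monoMap ν).symm

/-- `fullSML = ∏_i ∑_j x_{ij}`. -/
theorem fullSML_eq_prod_sum : fullSML n = ∏ i : Fin n, ∑ j : Fin n, X (i, j) := by
  rw [fullSML_eq_sum_prod, Finset.prod_univ_sum]
  simp only [Fintype.piFinset_univ]

/-- Every map monomial has coefficient `1` in `fullSML`. -/
theorem coeff_monoMap_fullSML (ν : Fin n → Fin n) : coeff (monoMap ν) (fullSML n) = 1 := by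
  unfold fullSML
  rw [coeff_sum, Finset.sum_eq_single ν]
  · rw [coeff_monomial, if_pos rfl]
  · intro ν' _ hne
    rw [coeff_monomial, if_neg]
    exact fun h => hne (monoMap_injective h)
  · intro h; exact absurd (mem_univ ν) h

/-- The coefficient of `x_ν` in `perNN` is `1` iff `ν` is a bijection. -/
theorem coeff_monoMap_perNN (ν : Fin n → Fin n) :
    coeff (monoMap ν) (perNN n) = if Function.Bijective ν then 1 else 0 := by
  unfold perNN
  rw [coeff_sum]
  by_cases hν : Function.Bijective ν
  · rw [if_pos hν, Finset.sum_eq_single (Equiv.ofBijective ν hν)]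
    · rw [coeff_monomial]
      exact if_pos rfl
    · intro σ _ hne
      rw [coeff_monomial, if_neg]
      intro h
      apply hne
      refine Equiv.ext fun x => ?_
      rw [Equiv.ofBijective_apply]
      exact congrFun (monoMap_injective h) x
    · intro h; exact absurd (mem_univ _) h
  · rw [if_neg hν]
    refine sum_eq_zero fun σ _ => ?_
    rw [coeff_monomial, if_neg]
    intro h
    apply hν
    rw [← monoMap_injective h]
    exact σ.bijective

/-- The coefficient of `x_ν` in the rung: `1 + M·[ν bijective]`. -/
theorem coeff_monoMap_ladder (M : ℝ≥0) (ν : Fin n → Fin n) :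
    coeff (monoMap ν) (ladder n M) = 1 + M * (if Function.Bijective ν then 1 else 0) := by
  unfold ladder
  rw [coeff_add, coeff_C_mul, coeff_monoMap_fullSML, coeff_monoMap_perNN]

/-- Coefficients of the rung at map monomials are `≤ 1 + M`. -/
theorem coeff_monoMap_ladder_le (M : ℝ≥0) (ν : Fin n → Fin n) :
    coeff (monoMap ν) (ladder n M) ≤ 1 + M := by
  rw [coeff_monoMap_ladder]
  split_ifs <;> simp

/-- At a non-bijection the rung has coefficient `1`. -/
theorem coeff_monoMap_ladder_of_not_bijective (M : ℝ≥0) {ν : Fin n → Fin n}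
    (h : ¬ Function.Bijective ν) : coeff (monoMap ν) (ladder n M) = 1 := by
  rw [coeff_monoMap_ladder, if_neg h, mul_zero, add_zero]

/-- The rung is supported on map monomials. -/
theorem exists_monoMap_of_coeff_ladder_ne_zero {M : ℝ≥0} {m : Fin n × Fin n →₀ ℕ}
    (h : coeff m (ladder n M) ≠ 0) : ∃ ν : Fin n → Fin n, m = monoMap ν := by
  by_contra hne
  push Not at hne
  apply h
  unfold ladder fullSML perNN
  have h1 : ∀ ν : Fin n → Fin n, coeff m (monomial (monoMap ν) (1 : ℝ≥0)) = 0 := fun ν => by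
    rw [coeff_monomial, if_neg (fun h' => hne ν h'.symm)]
  rw [coeff_add, coeff_C_mul, coeff_sum, coeff_sum]
  simp [h1]

/-- `F_{n,n} + M · per_n` is set-multilinear. -/
theorem isFullyOrdered_ladder (M : ℝ≥0) : IsFullyOrdered (ladder n M) := by
  intro m hm i
  obtain ⟨ν, rfl⟩ := exists_monoMap_of_coeff_ladder_ne_zero (mem_support_iff.1 hm)
  exact rowDegrees_monoMap ν i

/-! ### The permutation mass -/

/-- `μ(p) := ∑_{ν bijective} p(x_ν)`, as a real number. -/
def mass (p : MvPolynomial (Fin n × Fin n) ℝ≥0) : ℝ :=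
  ∑ f : Fin n → Fin n, if Function.Bijective f then ((coeff (monoMap f) p : ℝ≥0) : ℝ) else 0

/-- `mass` is additive. -/
theorem mass_add (p q : MvPolynomial (Fin n × Fin n) ℝ≥0) : mass (p + q) = mass p + mass q := by
  unfold mass
  rw [← sum_add_distrib]
  refine sum_congr rfl fun f _ => ?_
  split_ifs <;> simp [coeff_add]

/-- `mass` of a list sum. -/
theorem mass_list_sum (l : List (MvPolynomial (Fin n × Fin n) ℝ≥0)) :
    mass l.sum = (l.map mass).sum := by
  induction l with
  | nil => simp [mass]
  | cons p l ih => rw [List.sum_cons, mass_add, ih, List.map_cons, List.sum_cons]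

/-- `μ(F + M per) ≥ n! (1+M)` (in fact equality). -/
theorem mass_ladder_ge (M : ℝ≥0) : (n ! : ℝ) * (1 + M) ≤ mass (ladder n M) := by
  unfold mass
  have h : ∀ f : Fin n → Fin n,
      (if Function.Bijective f then ((coeff (monoMap f) (ladder n M) : ℝ≥0) : ℝ) else 0)
        = if Function.Bijective f then (1 + (M : ℝ)) else 0 := by
    intro f
    split_ifs with hf
    · rw [coeff_monoMap_ladder, if_pos hf]; push_cast; ring
    · rfl
  simp_rw [h]
  rw [← Finset.sum_filter, sum_const, nsmul_eq_mul]
  have hcard : n ! ≤ ((univ : Finset (Fin n → Fin n)).filter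
      fun f => Function.Bijective f).card := by
    calc n ! = (univ : Finset (Equiv.Perm (Fin n))).card := by
            rw [card_univ, Fintype.card_perm, Fintype.card_fin]
      _ = ((univ : Finset (Equiv.Perm (Fin n))).image
            fun σ : Equiv.Perm (Fin n) => (⇑σ : Fin n → Fin n)).card := by
            rw [card_image_of_injective _ DFunLike.coe_injective]
      _ ≤ _ := by
            refine card_le_card fun f hf => ?_
            rw [mem_image] at hf
            obtain ⟨σ, _, rfl⟩ := hf
            rw [mem_filter]
            exact ⟨mem_univ _, σ.bijective⟩
  have h0 : (0 : ℝ) ≤ 1 + (M : ℝ) := by positivity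
  exact mul_le_mul_of_nonneg_right (by exact_mod_cast hcard) h0

/-! ### Gluing Alice's and Bob's maps -/

/-- The glued map of `τ : A → [n]` and `θ : Aᶜ → [n]` is a bijection iff both are injective
with complementary images. -/
theorem bijective_glue_iff (A : Finset (Fin n)) (τ : {i // i ∈ A} → Fin n)
    (θ : {i // i ∈ Aᶜ} → Fin n) :
    Function.Bijective ((splitEquiv A).symm (τ, θ)) ↔
      Function.Injective τ ∧ Function.Injective θ ∧
        (univ.image θ)ᶜ = univ.image τ := by
  set f := (splitEquiv A).symm (τ, θ) with hf
  have hτ : ∀ i : {i // i ∈ A}, f i.1 = τ i := fun i => splitEquiv_symm_apply_mem A τ θ i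
  have hθ : ∀ i : {i // i ∈ Aᶜ}, f i.1 = θ i := fun i => splitEquiv_symm_apply_compl A τ θ i
  constructor
  · intro hb
    refine ⟨fun i j h => ?_, fun i j h => ?_, ?_⟩
    · exact Subtype.ext (hb.1 (by rw [hτ, hτ]; exact h))
    · exact Subtype.ext (hb.1 (by rw [hθ, hθ]; exact h))
    · ext j
      rw [mem_compl, mem_image, mem_image]
      constructor
      · intro hno
        obtain ⟨x, hx⟩ := hb.2 j
        by_cases hxA : x ∈ A
        · exact ⟨⟨x, hxA⟩, mem_univ _, by rw [← hτ ⟨x, hxA⟩]; exact hx⟩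
        · exact absurd ⟨⟨x, mem_compl.2 hxA⟩, mem_univ _, by
            rw [← hθ ⟨x, mem_compl.2 hxA⟩]; exact hx⟩ hno
      · rintro ⟨i', -, hi'⟩ ⟨i, -, hi⟩
        have heq : (i.1 : Fin n) = i'.1 := hb.1 (by rw [hθ, hτ, hi, hi'])
        have h1 := i.2
        rw [heq, mem_compl] at h1
        exact h1 i'.2
  · rintro ⟨hiτ, hiθ, him⟩
    apply Finite.injective_iff_bijective.1
    intro x y hxy
    by_cases hx : x ∈ A <;> by_cases hy : y ∈ A
    · have := hiτ (show τ ⟨x, hx⟩ = τ ⟨y, hy⟩ by rw [← hτ ⟨x, hx⟩, ← hτ ⟨y, hy⟩]; exact hxy)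
      exact congrArg Subtype.val this
    · exfalso
      have h1 : f x ∈ univ.image τ := mem_image.2 ⟨⟨x, hx⟩, mem_univ _, (hτ ⟨x, hx⟩).symm⟩
      have h2 : f y ∈ univ.image θ :=
        mem_image.2 ⟨⟨y, mem_compl.2 hy⟩, mem_univ _, (hθ ⟨y, mem_compl.2 hy⟩).symm⟩
      rw [← him, mem_compl, hxy] at h1
      exact h1 h2
    · exfalso
      have h1 : f y ∈ univ.image τ := mem_image.2 ⟨⟨y, hy⟩, mem_univ _, (hτ ⟨y, hy⟩).symm⟩
      have h2 : f x ∈ univ.image θ :=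
        mem_image.2 ⟨⟨x, mem_compl.2 hx⟩, mem_univ _, (hθ ⟨x, mem_compl.2 hx⟩).symm⟩
      rw [← him, mem_compl, ← hxy] at h1
      exact h1 h2
    · have := hiθ (show θ ⟨x, mem_compl.2 hx⟩ = θ ⟨y, mem_compl.2 hy⟩ by
        rw [← hθ ⟨x, mem_compl.2 hx⟩, ← hθ ⟨y, mem_compl.2 hy⟩]; exact hxy)
      exact congrArg Subtype.val this

/-- Coefficient of an ordered product at a glued map. -/
theorem coeff_glue {A : Finset (Fin n)} {a b : MvPolynomial (Fin n × Fin n) ℝ≥0}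
    (ha : IsOrdered A a) (hb : IsOrdered Aᶜ b) (τ : {i // i ∈ A} → Fin n)
    (θ : {i // i ∈ Aᶜ} → Fin n) :
    coeff (monoMap ((splitEquiv A).symm (τ, θ))) (a * b) =
      coeff (monoOf A τ) a * coeff (monoOf Aᶜ θ) b := by
  rw [coeff_monoMap_mul ha hb]
  have h1 : (fun i : {i // i ∈ A} => (splitEquiv A).symm (τ, θ) i.1) = τ :=
    funext fun i => splitEquiv_symm_apply_mem A τ θ i
  have h2 : (fun i : {i // i ∈ Aᶜ} => (splitEquiv A).symm (τ, θ) i.1) = θ :=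
    funext fun i => splitEquiv_symm_apply_compl A τ θ i
  rw [h1, h2]

/-! ### Counting injective maps -/

/-- Injective maps `B → [n]` number at most `n (n-1) ⋯ (n-|B|+1)`. -/
theorem card_filter_injective_le (B : Finset (Fin n)) :
    ((univ : Finset ({i // i ∈ B} → Fin n)).filter fun θ => Function.Injective θ).card
      ≤ n.descFactorial B.card := by
  set E := (univ : Finset ({i // i ∈ B} → Fin n)).filter fun θ => Function.Injective θ with hE
  let F : {θ // θ ∈ E} → ({i // i ∈ B} ↪ Fin n) := fun θ => ⟨θ.1, (mem_filter.1 θ.2).2⟩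
  have hF : Function.Injective F := by
    intro θ θ' h
    have h' := congrArg (fun e : {i // i ∈ B} ↪ Fin n => (e : {i // i ∈ B} → Fin n)) h
    exact Subtype.ext h'
  have := Fintype.card_le_of_injective F hF
  rwa [Fintype.card_coe, Fintype.card_embedding_eq, Fintype.card_coe, Fintype.card_fin] at this

/-- A set of injective maps `B → [n]` with a common image has at most `|B|!` elements. -/
theorem card_le_factorial_of_injective_image {B T : Finset (Fin n)}
    (E : Finset ({i // i ∈ B} → Fin n))
    (hE : ∀ θ ∈ E, Function.Injective θ ∧ univ.image θ = T) : E.card ≤ B.card ! := by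
  by_cases hT : T.card = B.card
  · have hmem : ∀ θ : {θ // θ ∈ E}, ∀ i, θ.1 i ∈ T := fun θ i => by
      rw [← (hE θ.1 θ.2).2]; exact mem_image_of_mem _ (mem_univ i)
    let F : {θ // θ ∈ E} → ({i // i ∈ B} ↪ {j // j ∈ T}) := fun θ =>
      ⟨fun i => ⟨θ.1 i, hmem θ i⟩, fun i j h => (hE θ.1 θ.2).1 (congrArg Subtype.val h)⟩
    have hF : Function.Injective F := by
      intro θ θ' h
      apply Subtype.ext
      funext i
      have := congrArg (fun e : {i // i ∈ B} ↪ {j // j ∈ T} => ((e i).1 : Fin n)) h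
      exact this
    have := Fintype.card_le_of_injective F hF
    rwa [Fintype.card_coe, Fintype.card_embedding_eq, Fintype.card_coe, Fintype.card_coe, hT,
      Nat.descFactorial_self] at this
  · refine not_lt.1 fun hlt => hT ?_
    obtain ⟨θ, hθ⟩ := Finset.card_pos.1 (lt_of_le_of_lt (Nat.zero_le _) hlt)
    have h := hE θ hθ
    rw [← h.2, card_image_of_injective _ h.1, card_univ, Fintype.card_coe]

/-- Injective maps `B → [n]` with prescribed image number at most `|B|!`. -/
theorem card_filter_injective_image_le (B T : Finset (Fin n)) :
    (((univ : Finset ({i // i ∈ B} → Fin n)).filter fun θ => Function.Injective θ).filter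
        fun θ => univ.image θ = T).card ≤ B.card ! :=
  card_le_factorial_of_injective_image _ fun θ h => by
    rw [mem_filter, mem_filter] at h
    exact ⟨h.1.2, h.2⟩

/-! ### Arithmetic -/

/-- `2^j ≤ C(n,k)` for `j ≤ min(k, n-k)`. -/
theorem two_pow_le_choose {j n k : ℕ} (h1 : j ≤ k) (h2 : j ≤ n - k) (hk : k ≤ n) :
    2 ^ j ≤ n.choose k := by
  induction j generalizing n k with
  | zero => rw [pow_zero]; exact Nat.choose_pos hk
  | succ j ih =>
    obtain ⟨n', rfl⟩ : ∃ n', n = n' + 1 := ⟨n - 1, by omega⟩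
    obtain ⟨k', rfl⟩ : ∃ k', k = k' + 1 := ⟨k - 1, by omega⟩
    have ha : 2 ^ j ≤ n'.choose k' := ih (by omega) (by omega) (by omega)
    have hb : 2 ^ j ≤ n'.choose (k' + 1) := ih (by omega) (by omega) (by omega)
    rw [Nat.choose_succ_succ', pow_succ]
    omega

/-- In the balanced range `n < 3k ≤ 2n`: `k!(n-k)! · 2^{⌈n/3⌉} ≤ n!`. -/
theorem factorial_mul_factorial_mul_two_pow_le {n k : ℕ} (h1 : n < 3 * k) (h2 : 3 * k ≤ 2 * n) :
    (k ! * (n - k) ! : ℝ) * 2 ^ ((n + 2) / 3) ≤ n ! := by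
  have hk : k ≤ n := by omega
  have hc := two_pow_le_choose (j := (n + 2) / 3) (n := n) (k := k) (by omega) (by omega) hk
  have he := Nat.choose_mul_factorial_mul_factorial hk
  have : k ! * (n - k) ! * 2 ^ ((n + 2) / 3) ≤ n ! := by
    calc k ! * (n - k) ! * 2 ^ ((n + 2) / 3) ≤ k ! * (n - k) ! * n.choose k :=
          Nat.mul_le_mul_left _ hc
      _ = n ! := by rw [← he]; ring
  exact_mod_cast this

/-- `μ² ≤ Zμ + ZN` with `Z, N ≥ 0` forces `μ ≤ Z + √(ZN)`. -/
theorem le_add_sqrt_of_sq_le {μ Z N : ℝ} (hZ : 0 ≤ Z) (hN : 0 ≤ N)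
    (h : μ ^ 2 ≤ Z * μ + Z * N) : μ ≤ Z + Real.sqrt (Z * N) := by
  by_contra hlt
  push Not at hlt
  have hr := Real.sq_sqrt (mul_nonneg hZ hN)
  have hr0 := Real.sqrt_nonneg (Z * N)
  have hgap : 0 < μ - Z - Real.sqrt (Z * N) := by linarith
  have hμpos : 0 < μ := by linarith
  nlinarith [mul_pos hμpos hgap, mul_nonneg hr0 hgap.le, mul_nonneg hr0 hZ, hr]

end PlusLadder

end Summit.ValiantsHypothesis.ValiantsHypothesis.Theorems
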